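import Summits.MatrixMultiplication.MatrixMultiplication.Theorems.AbelianSTPPCensusTB5StatSplit

/-!
# T_B static certificate, range `5995 … 6012` (multi-parameter k-member tree at `τ = 2375/1000`): kernel pieces of the cell `(14, 16, 16)` (volume `3584`) at the order `6002`, part 3/3

Cell mm-stpp (rung F-M1), tier T_B = «beat `2.375` (Coppersmith–Winograd)»; seat mm-stpp-vp-p2 (gen 7).  Root-split layout (`AbelianSTPPCensusTAStatKMemberXSplit.lean`, `…XWalk.lean`, `AbelianSTPPCensusTB5StatSplit.lean`): the (cell, order) tree has
354862 nodes — beyond one `decide` — and is cut along list positions into `goIR` pieces / small subtrees / descent children of ≤ 4·10⁴ nodes each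
(this file: 5 pieces, 66081 nodes; sizes from the exact twin seat twin/tastat9.py, kit j314356), assembled in `AbelianSTPPCensusTB5StatCkS6002.lean`.
`decide` with kernel reduction (standard axioms; no `native_decide`), `Elab.async false`.
WHAT THIS IS NOT: arithmetic on shape lists only; no statement about STPP families or `ω`.
-/

set_option linter.dupNamespace false
set_option autoImplicit false
set_option Elab.async false

namespace Summit.MatrixMultiplication.MatrixMultiplication.Theorems.TB5Stat

open ShapeCert (gainOfTBV)
open TECert (vol)

set_option maxHeartbeats 0 in
/-- descent child to bucket `69` (28346 nodes) [original] -/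
theorem s6002b70rc1c0d : TAStatKM.treeKX tb m2l gainOfTBV (rowOf 3584) (xrowOf 3584) (gainOfTBV 3584) 704 3584 1362 14 224 6002 kmax 79 (TAStatKM.addM (gainOfTBV (vol (14, 16, 16))) (TAStatKM.addM (gainOfTBV (vol (14, 16, 16))) TAStatKM.agg0 (14, 16, 16)) (14, 16, 16)) 69 (m2l 69) = true := by decide +kernel

set_option maxHeartbeats 0 in
/-- positions `1 … 100` of a node at bucket `70` (1 companion(s), list from `1`): 0 nodes [original] -/
theorem s6002b70rc1g1 : TAStatKM.goIR gainOfTBV 3584 (fun A' ms' => TAStatKM.treeKX tb m2l gainOfTBV (rowOf 3584) (xrowOf 3584) (gainOfTBV 3584) 704 3584 1362 14 224 6002 kmax 80 A' 70 ms') (TAStatKM.addM (gainOfTBV (vol (14, 16, 16))) TAStatKM.agg0 (14, 16, 16)) ((14, 16, 16) :: (m2l 70).drop 2) 1 100 = true := by decide +kernel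

set_option maxHeartbeats 0 in
/-- descent child to bucket `69` (21606 nodes) [original] -/
theorem s6002b70rc1d : TAStatKM.treeKX tb m2l gainOfTBV (rowOf 3584) (xrowOf 3584) (gainOfTBV 3584) 704 3584 1362 14 224 6002 kmax 80 (TAStatKM.addM (gainOfTBV (vol (14, 16, 16))) TAStatKM.agg0 (14, 16, 16)) 69 (m2l 69) = true := by decide +kernel

set_option maxHeartbeats 0 in
/-- root positions `2 … 101` (bucket `70`, order `6002`): 0 nodes [original] -/
theorem s6002b70rg2 : TAStatKM.goIR gainOfTBV 3584 (fun A' ms' => TAStatKM.treeKX tb m2l gainOfTBV (rowOf 3584) (xrowOf 3584) (gainOfTBV 3584) 704 3584 1362 14 224 6002 kmax 81 A' 70 ms') TAStatKM.agg0 (m2l 70) 2 100 = true := by decide +kernel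

set_option maxHeartbeats 0 in
/-- root descent child to bucket `69` (16129 nodes) [original] -/
theorem s6002b70rd : TAStatKM.treeKX tb m2l gainOfTBV (rowOf 3584) (xrowOf 3584) (gainOfTBV 3584) 704 3584 1362 14 224 6002 kmax 81 TAStatKM.agg0 69 (m2l 69) = true := by decide +kernel

end Summit.MatrixMultiplication.MatrixMultiplication.Theorems.TB5Stat
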